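import Mathlib.RingTheory.AlgebraicIndependent.Basic
import Mathlib.Algebra.MvPolynomial.Funext
import Mathlib.RingTheory.MvPolynomial.Tower
import Literature.ModelTheory.ExponentialFields.SemialgebraicInterior
import HarnessLib

/-!
# SoloInformed — generic real parameters: corollary (GEN) of the `KZ_ℝ` method barrier

Solo programme `solo-KontsevichZagierPeriods-informed`, session s137, file 5 (companion of files
490–493, `SoloInformedAlgebraicParameterTransfer` … `SoloInformedRealParameterTransferCore`).
The remaining real-algebraic step of `paper/real-parameters.md` — COROLLARY (GEN) of THEOREM R:
"if the parameter vector `p` is GENERIC (coordinates algebraically independent over `ℚ`), the value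
is constant on a non-empty open set of parameters; so `[0, ℓ]`-type targets are never reached from
`ℚ`-data at generic parameters" — in the kernel, for every coefficient ring `k → ℝ` and every index
type:

* `soloInformed_nhds_or_compl_mem_nhds_of_algebraicIndependent` — **generic points are generic for
  semialgebraic sets**: if `x : ι → ℝ` has `k`-algebraically independent coordinates, every
  `k`-semialgebraic `s` is a neighbourhood of `x` or of its complement (the tree's
  `nhds_or_compl_mem_nhds_of_transcendental` is `ι = Fin 1`, `k = ℚ`); hence a `k`-semialgebraic set
  containing a generic point is a neighbourhood of it (`…mem_nhds…`, `…mem_interior…`), and a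
  `k`-semialgebraic set with empty interior contains no generic point.
* `soloInformed_eq_C_of_generic_valid` — **(GEN)**: if a `ℚ`-semialgebraic validity condition holds
  at a generic parameter vector and soundness pins a rational polynomial `value` of the parameters
  to a fixed real `τ` at every valid parameter, then `value` is a CONSTANT polynomial `C c` and
  `τ = c ∈ ℚ` (identity principle for polynomials on the open set of valid parameters);
  in particular (`soloInformed_not_valid_generic_of_coord_pinned`) when the pinned value is a
  COORDINATE (the `ℓ` of the target `[0,1] × [0,ℓ]` in THEOREM R) no generic parameter is valid.

As for files 490–493, what stays PAPER is only the deep embedding "validity of a fixed-shape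
`KZ_ℝ` chain is a `ℚ`-semialgebraic condition on its real parameters".

References: paper `real-parameters.md` (THEOREM R, COROLLARY); Bochnak–Coste–Roy (1998) §2.8.
-/

noncomputable section

namespace Summit.KontsevichZagierPeriods.KontsevichZagierPeriods.Theorems

open Set Filter Topology MvPolynomial Literature.ModelTheory.ExponentialFields

variable {k : Type*} [CommRing k] [Algebra k ℝ] {ι : Type*}

/-- **Generic points are generic for semialgebraic sets.** If the coordinates of `x : ι → ℝ` are
algebraically independent over `k`, then every `k`-semialgebraic set is a neighbourhood of `x` or
of its complement: a non-zero polynomial over `k` does not vanish at `x` and its sign is locally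
constant; induction over the generating Boolean algebra. [cite: BochnakCosteRoy1998, §2.8] -/
theorem soloInformed_nhds_or_compl_mem_nhds_of_algebraicIndependent {x : ι → ℝ}
    (hx : AlgebraicIndependent k x) {s : Set (ι → ℝ)} (hs : IsSemialgebraic k s) :
    s ∈ 𝓝 x ∨ sᶜ ∈ 𝓝 x := by
  have hne : ∀ p : MvPolynomial ι k, p ≠ 0 → aeval x p ≠ 0 := fun p hp h =>
    hp (hx (by rw [h, map_zero]))
  induction hs using BooleanSubalgebra.closure_bot_sup_induction with
  | mem t ht =>
    rcases ht with ⟨p, rfl⟩ | ⟨p, rfl⟩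
    · by_cases hp : p = 0
      · left
        subst hp
        simp
      · right
        have hopen : IsOpen {y : ι → ℝ | aeval y p ≠ 0} :=
          isOpen_ne_fun (continuous_aeval_real p) continuous_const
        simpa [compl_setOf] using hopen.mem_nhds (hne p hp)
    · by_cases hp : p = 0
      · right
        subst hp
        simp
      · rcases lt_or_gt_of_ne (hne p hp) with hlt | hgt
        · right
          have hopen : IsOpen {y : ι → ℝ | aeval y p < 0} :=
            isOpen_lt (continuous_aeval_real p) continuous_const
          filter_upwards [hopen.mem_nhds hlt] with y hy
          simp only [mem_compl_iff, mem_setOf_eq, not_lt]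
          exact le_of_lt hy
        · exact Or.inl ((isOpen_lt continuous_const (continuous_aeval_real p)).mem_nhds hgt)
  | bot =>
    right
    simp
  | sup t _ u _ iht ihu =>
    rcases iht with ht | ht
    · exact Or.inl (mem_of_superset ht subset_union_left)
    · rcases ihu with hu | hu
      · exact Or.inl (mem_of_superset hu subset_union_right)
      · right
        have h : (t ⊔ u)ᶜ = tᶜ ∩ uᶜ := compl_union t u
        rw [h]
        exact inter_mem ht hu
  | compl t _ iht =>
    rcases iht with ht | ht
    · right
      simpa only [compl_compl] using ht
    · exact Or.inl ht

/-- A `k`-semialgebraic set containing a generic point is a neighbourhood of it.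
[cite: BochnakCosteRoy1998, §2.8] -/
theorem soloInformed_mem_nhds_of_algebraicIndependent {x : ι → ℝ} (hx : AlgebraicIndependent k x)
    {s : Set (ι → ℝ)} (hs : IsSemialgebraic k s) (hxs : x ∈ s) : s ∈ 𝓝 x := by
  rcases soloInformed_nhds_or_compl_mem_nhds_of_algebraicIndependent hx hs with h | h
  · exact h
  · exact absurd hxs (mem_of_mem_nhds h)

/-- A generic point of a `k`-semialgebraic set is an interior point.
[cite: BochnakCosteRoy1998, §2.8] -/
theorem soloInformed_mem_interior_of_algebraicIndependent {x : ι → ℝ}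
    (hx : AlgebraicIndependent k x) {s : Set (ι → ℝ)} (hs : IsSemialgebraic k s) (hxs : x ∈ s) :
    x ∈ interior s :=
  mem_interior_iff_mem_nhds.2 (soloInformed_mem_nhds_of_algebraicIndependent hx hs hxs)

/-- A `k`-semialgebraic set with empty interior contains no generic point.
[cite: BochnakCosteRoy1998, §2.8] -/
theorem soloInformed_not_mem_of_interior_eq_empty {x : ι → ℝ} (hx : AlgebraicIndependent k x)
    {s : Set (ι → ℝ)} (hs : IsSemialgebraic k s) (hint : interior s = ∅) : x ∉ s := fun hxs => by
  have := soloInformed_mem_interior_of_algebraicIndependent hx hs hxs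
  rw [hint] at this
  exact this

/-- A polynomial over `ℝ` (finitely many variables) vanishing on a neighbourhood of a point is zero
(identity principle, the tree's `interior_setOf_aeval_eq_zero`, plus `MvPolynomial.funext`).
[cite: BochnakCosteRoy1998, §2.8] -/
theorem soloInformed_mvPolynomial_eq_zero_of_eventuallyEq {ι : Type*} [Fintype ι]
    (r : MvPolynomial ι ℝ) {x : ι → ℝ} (h : {y : ι → ℝ | aeval y r = 0} ∈ 𝓝 x) : r = 0 := by
  have hall : ∀ y : ι → ℝ, aeval y r = 0 := by
    by_contra hcon
    push Not at hcon
    have hint := interior_setOf_aeval_eq_zero (k := ℝ) r hcon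
    have hx : x ∈ interior {y : ι → ℝ | aeval y r = 0} := mem_interior_iff_mem_nhds.2 h
    rw [hint] at hx
    exact hx
  exact MvPolynomial.funext fun y => by simpa [MvPolynomial.coe_aeval_eq_eval] using hall y

/-- **COROLLARY (GEN) of THEOREM R.** Let `Valid` be a `ℚ`-semialgebraic condition on real parameter
vectors and suppose soundness pins a rational polynomial `value` of the parameters to one real `τ`
at every valid parameter.  If some GENERIC parameter vector (coordinates algebraically independent
over `ℚ`) is valid, then `value` is the constant polynomial `C c` and `τ = c` is RATIONAL: the valid
set is a neighbourhood of the generic point, on which `value − τ` vanishes identically.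
[cite: BochnakCosteRoy1998, §2.8] -/
theorem soloInformed_eq_C_of_generic_valid {n : ℕ} {Valid : (Fin n → ℝ) → Prop}
    (hV : IsSemialgebraic ℚ {p | Valid p}) (value : MvPolynomial (Fin n) ℚ) {τ : ℝ}
    (hsound : ∀ p, Valid p → aeval p value = τ) {x : Fin n → ℝ} (hx : AlgebraicIndependent ℚ x)
    (hVx : Valid x) : ∃ c : ℚ, value = C c ∧ τ = c := by
  set r : MvPolynomial (Fin n) ℝ := MvPolynomial.map (algebraMap ℚ ℝ) value - C τ with hr
  have hzero : {y : Fin n → ℝ | aeval y r = 0} ∈ 𝓝 x := by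
    filter_upwards [soloInformed_mem_nhds_of_algebraicIndependent hx hV hVx] with y hy
    have hy' : aeval y value = τ := hsound y hy
    simp only [hr, map_sub, MvPolynomial.aeval_map_algebraMap, MvPolynomial.aeval_C,
      Algebra.algebraMap_self, RingHom.id_apply, hy', sub_self]
  have hr0 : r = 0 := soloInformed_mvPolynomial_eq_zero_of_eventuallyEq r hzero
  have hmap : MvPolynomial.map (algebraMap ℚ ℝ) value = C τ := by
    simpa [hr, sub_eq_zero] using hr0
  have hcoeff : ∀ m : Fin n →₀ ℕ, m ≠ 0 → coeff m value = 0 := fun m hm => by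
    have := congrArg (coeff m) hmap
    rw [coeff_map, coeff_C, if_neg (Ne.symm hm), eq_ratCast] at this
    exact_mod_cast this
  have h0 : ((coeff 0 value : ℚ) : ℝ) = τ := by
    have := congrArg (coeff 0) hmap
    rw [coeff_map, coeff_C, if_pos rfl, eq_ratCast] at this
    exact this
  refine ⟨coeff 0 value, ?_, h0.symm⟩
  ext m
  by_cases hm : m = 0
  · subst hm
    simp
  · rw [coeff_C, if_neg (Ne.symm hm)]
    exact hcoeff m hm

/-- **(GEN), coordinate form (the case of THEOREM R).** If soundness pins a COORDINATE of the
parameter vector (the `ℓ` of the target `[0,1] × [0,ℓ]`) to a fixed real at every valid parameter,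
then no generic parameter vector is valid — a coordinate is not a constant polynomial.
[cite: BochnakCosteRoy1998, §2.8] -/
theorem soloInformed_not_valid_generic_of_coord_pinned {n : ℕ} {Valid : (Fin n → ℝ) → Prop}
    (hV : IsSemialgebraic ℚ {p | Valid p}) (i : Fin n) {τ : ℝ}
    (hsound : ∀ p, Valid p → p i = τ) {x : Fin n → ℝ} (hx : AlgebraicIndependent ℚ x) :
    ¬ Valid x := fun hVx => by
  obtain ⟨c, hc, -⟩ := soloInformed_eq_C_of_generic_valid hV (X i) (fun p hp => by
    simpa using hsound p hp) hx hVx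
  have h1 := congrArg (MvPolynomial.eval fun _ => (0 : ℚ)) hc
  have h2 := congrArg (MvPolynomial.eval fun _ => (1 : ℚ)) hc
  simp only [eval_X, eval_C] at h1 h2
  exact zero_ne_one (h1.trans h2.symm)

/-- The set of valid parameters of such a pinned-coordinate condition has EMPTY INTERIOR (it is a
`ℚ`-semialgebraic set of positive codimension): two valid parameters differing only in the pinned
coordinate cannot both give `τ`. [cite: BochnakCosteRoy1998, §2.8] -/
theorem soloInformed_interior_valid_eq_empty_of_coord_pinned {n : ℕ} {Valid : (Fin n → ℝ) → Prop}
    (i : Fin n) {τ : ℝ} (hsound : ∀ p, Valid p → p i = τ) :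
    interior {p : Fin n → ℝ | Valid p} = ∅ := by
  by_contra hne
  obtain ⟨p, hp⟩ := nonempty_iff_ne_empty.mpr hne
  rcases Metric.mem_nhds_iff.1 (mem_interior_iff_mem_nhds.1 hp) with ⟨ε, hε, hball⟩
  have h1 : Valid p := hball (Metric.mem_ball_self hε)
  have h2 : Valid (Function.update p i (p i + ε / 2)) := by
    apply hball
    rw [Metric.mem_ball, dist_pi_lt_iff hε]
    intro j
    by_cases hj : j = i
    · subst hj
      rw [Function.update_self, Real.dist_eq, add_sub_cancel_left, abs_of_pos (half_pos hε)]
      exact half_lt_self hε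
    · simp [Function.update_of_ne hj, hε]
  have := hsound _ h2
  rw [Function.update_self, hsound p h1] at this
  linarith

end Summit.KontsevichZagierPeriods.KontsevichZagierPeriods.Theorems
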